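import Mathlib
import HarnessLib
import Summits.Ventures.LatticeQCDFlow.Scaling.LinearFamilyTilt
import Summits.Ventures.LatticeQCDFlow.Scaling.LinearFamilyStepMGF
import Summits.Ventures.LatticeQCDFlow.Scaling.TiltedMarginals

/-!
# TiltedProtocolMass — the `t`-tilted recursion of the linear switching protocol with arbitrary
# layers: `E_F[e^{−tW}]` as a tilted mass, its perfect-relaxation value
# `log p_n^{(t)} + t·ΔF = Σ_k Λ_k(t)`, the `χ²` and the variance of the one-time weight INSIDE the
# family as one-step log-MGFs, and the SUP-NORM-FREE mass step
# `|m_{k+1} − ḡ_k m_k| ≤ ḡ_k·√(e^{Λ_{c_k,tδ_k}(2)} − 1)·E_k`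

HONEST FRAMING: exact (Metropolis-corrected) sampling algorithms for lattice gauge theory;
figures of merit are autocorrelation/cost numbers at stated couplings and volumes; no
continuum-physics claim.

Venture `LatticeQCDFlow` (cell pub-lqcd), topic `Scaling`; FANOUT row 19 (`su2-snf`, GEN-10).
OUR WORK (elementary finite sums), nothing here is cited as a fact.  Vocabulary: row 8's linear
family `linAction S₀ D c = S₀ + c•D`, `gibbsLaw`, `partitionFn`, `linFreeEnergy` (`Exactness/…`),
theory-2's `essFrac`, `weight`, `varLaw`, the Literature's Pearson `chiSqDiv`, and this seat's
`tiltEvolve` / `massDev` (`Scaling/TiltedMarginals`), tilt identities (`Scaling/LinearFamilyTilt`)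
and one-step log-MGF `stepLogMGF S₀ D c δ t = Λ_{c,δ}(t)` (`Scaling/LinearFamilyStepMGF`).
This is the layer-free part of the work-MGF / ESS-floor machinery, on BUILT parents only, shared
by the `χ²` route (staged `TiltedProtocolMoments`, GEN-6) and the hypercontractive route
(`Scaling/HypercontractiveDeviation`, `Scaling/HypercontractiveESSFloor`, GEN-10):

* §1 `tWeight t D c k = e^{−tδ_k D}` (`δ_k = c_{k+1} − c_k`), the `t`-TILTED MARGINAL
  `tTiltLaw t S₀ D c P` (`ν_0 = π_{c_0}`, `ν_{k+1} = (g_k ν_k)P_k`), the perfect-relaxation mass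
  `tPerfMass` (`p_k = Π_{i<k} ḡ_i`, `ḡ_i = π_{c_i}[g_i] = Z(c_i + tδ_i)/Z(c_i)`, `tEqFactor_eq`);
  **`sum_pathLaw_exp_neg_mul_work_eq`** (`E_F[e^{−tW}] = |ν_n|`), `tTiltLaw_perfect`
  (perfect layers: `ν_k = p_k π_{c_k}`), **`log_tPerfMass_add_eq_sum_stepLogMGF`**
  (`log p_n + t(F(c_n) − F(c_0)) = Σ_{k<n} Λ_{c_k,δ_k}(t)`);
* §2 INSIDE THE FAMILY EVERYTHING IS A LOG-MGF: `chiSqDiv_eq_inv_essFrac_sub_one`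
  (`χ² = 1/ESS − 1`), **`chiSqDiv_gibbsLaw_linAction_eq`** (`χ²(π_{c+a} ‖ π_c) = e^{Λ_{c,a}(2)} − 1`),
  `chiSqDiv_gibbsLaw_linAction_le` (`≤ e^{a²σ̄²} − 1` when `Var_c(D) ≤ σ̄²` for all `c`),
  **`varLaw_tWeight_eq`** (`Var_{π_{c_k}}(g_k) = ḡ_k²(e^{Λ_{c_k,tδ_k}(2)} − 1)`) and
  `sqrt_varLaw_tWeight_le` (`√Var ≤ ḡ_k √(e^{t²δ_k²σ̄²} − 1)`): the relative standard deviation of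
  the one-time weight is controlled by the FLUCTUATION `δσ̄`, never by the oscillation `δ·ΔD`;
* §3 the tilted lag bound `abs_sum_mul_sub_mass_mul_le` (`|ν[g] − |ν|π[g]| ≤ √Var_π(g)·massDev π ν`,
  Cauchy–Schwarz in `L²(π)`: `sum_mul_mul_le_sqrt_mul_sqrt`) and **THE MASS STEP**
  `abs_sum_tTiltLaw_succ_sub_le`: `|m_{k+1} − ḡ_k m_k| ≤ ḡ_k √(e^{Λ_{c_k,tδ_k}(2)} − 1)·E_k`
  (`E_k = massDev π_{c_k} ν_k`; unit row sums only).

NOT CLAIMED: any deviation step (that needs a hypothesis on the layers: `χ²`-contraction in the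
staged GEN-6 files, hypercontractivity in `Scaling/HypercontractiveDeviation`).
-/

namespace Summit.Ventures.LatticeQCDFlow.Scaling

open Finset
open Literature.Probability.MarkovChains (stepLaw)
open Literature.Probability.ImportanceSampling (chiSqDiv chiSqDiv_def chiSqDiv_eq_sum_sq_div)
open Summit.Ventures.LatticeQCDFlow.Exactness
open Summit.Ventures.LatticeQCDFlow.Theory2

variable {X : Type*} [Fintype X]

/-! ## §1 The `t`-tilted recursion of the linear protocol -/

section Protocol

variable [Nonempty X]

/-- The ONE-TIME WEIGHT of order `t` of step `k` along the grid `c`: `g_k = e^{−tδ_k D}`,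
`δ_k = c_{k+1} − c_k` (so that `e^{−tW} = Π_k g_k(ω_k)`). -/
noncomputable def tWeight (t : ℝ) (D : X → ℝ) (c : ℕ → ℝ) (k : ℕ) (x : X) : ℝ :=
  Real.exp (-(t * (c (k + 1) - c k) * D x))

/-- The `t`-TILTED MARGINAL `ν_k^{(t)}`: `ν_0 = π_{c_0}`, `ν_{k+1} = (g_k ν_k) P_k`;
`|ν_n^{(t)}| = E_F[e^{−tW}]`. -/
noncomputable def tTiltLaw (t : ℝ) (S₀ D : X → ℝ) (c : ℕ → ℝ) (P : ℕ → X → X → ℝ) : ℕ → X → ℝ :=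
  tiltEvolve (tWeight t D c) P (gibbsLaw (linAction S₀ D (c 0)))

/-- The PERFECT-RELAXATION `t`-MOMENT up to step `k`: `p_k^{(t)} = Π_{i<k} π_{c_i}[g_i]
= Π_{i<k} Z(c_i + tδ_i)/Z(c_i)`. -/
noncomputable def tPerfMass (t : ℝ) (S₀ D : X → ℝ) (c : ℕ → ℝ) (k : ℕ) : ℝ :=
  ∏ i ∈ Finset.range k, ∑ x, gibbsLaw (linAction S₀ D (c i)) x * tWeight t D c i x

omit [Fintype X] [Nonempty X] in
/-- The one-time weight of order `t` is positive. -/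
theorem tWeight_pos (t : ℝ) (D : X → ℝ) (c : ℕ → ℝ) (k : ℕ) (x : X) : 0 < tWeight t D c k x :=
  Real.exp_pos _

/-- `ḡ_k = π_{c_k}[g_k] = Z(c_k + tδ_k)/Z(c_k)`. -/
theorem tEqFactor_eq (t : ℝ) (S₀ D : X → ℝ) (c : ℕ → ℝ) (k : ℕ) :
    ∑ x, gibbsLaw (linAction S₀ D (c k)) x * tWeight t D c k x
      = partitionFn (linAction S₀ D (c k + t * (c (k + 1) - c k)))
          / partitionFn (linAction S₀ D (c k)) :=
  sum_gibbsLaw_linAction_mul_exp S₀ D (c k) (t * (c (k + 1) - c k))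

/-- The equilibrium factor `ḡ_k` is positive. -/
theorem tEqFactor_pos (t : ℝ) (S₀ D : X → ℝ) (c : ℕ → ℝ) (k : ℕ) :
    0 < ∑ x, gibbsLaw (linAction S₀ D (c k)) x * tWeight t D c k x :=
  sum_gibbsLaw_linAction_mul_exp_pos S₀ D (c k) _

omit [Nonempty X] in
/-- `p_{k+1}^{(t)} = p_k^{(t)} · ḡ_k`. -/
theorem tPerfMass_succ (t : ℝ) (S₀ D : X → ℝ) (c : ℕ → ℝ) (k : ℕ) :
    tPerfMass t S₀ D c (k + 1)
      = tPerfMass t S₀ D c k * ∑ x, gibbsLaw (linAction S₀ D (c k)) x * tWeight t D c k x :=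
  Finset.prod_range_succ _ _

/-- `p_k^{(t)} > 0`. -/
theorem tPerfMass_pos (t : ℝ) (S₀ D : X → ℝ) (c : ℕ → ℝ) (k : ℕ) : 0 < tPerfMass t S₀ D c k :=
  prod_pos fun i _ => tEqFactor_pos t S₀ D c i

/-- `T_{g_k} π_{c_k} = π_{c_k + tδ_k}`: tilting by the one-time weight moves along the family. -/
theorem tilt_gibbsLaw_eq_t (t : ℝ) (S₀ D : X → ℝ) (c : ℕ → ℝ) (k : ℕ) :
    (fun x => gibbsLaw (linAction S₀ D (c k)) x * tWeight t D c k x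
        / ∑ y, gibbsLaw (linAction S₀ D (c k)) y * tWeight t D c k y)
      = gibbsLaw (linAction S₀ D (c k + t * (c (k + 1) - c k))) := by
  funext x
  exact (gibbsLaw_linAction_add S₀ D (c k) (t * (c (k + 1) - c k)) x).symm

omit [Nonempty X] in
/-- `ν_0^{(t)} = π_{c_0}`. -/
theorem tTiltLaw_zero (t : ℝ) (S₀ D : X → ℝ) (c : ℕ → ℝ) (P : ℕ → X → X → ℝ) :
    tTiltLaw t S₀ D c P 0 = gibbsLaw (linAction S₀ D (c 0)) := rfl

omit [Nonempty X] in
/-- `ν_{k+1}^{(t)} = (g_k ν_k^{(t)}) P_k`. -/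
theorem tTiltLaw_succ (t : ℝ) (S₀ D : X → ℝ) (c : ℕ → ℝ) (P : ℕ → X → X → ℝ) (k : ℕ) :
    tTiltLaw t S₀ D c P (k + 1)
      = stepLaw (P k) (fun x => tWeight t D c k x * tTiltLaw t S₀ D c P k x) := rfl

/-- Positive layers keep the `t`-tilted marginal positive. -/
theorem tTiltLaw_pos {t : ℝ} {S₀ D : X → ℝ} {c : ℕ → ℝ} {P : ℕ → X → X → ℝ}
    (hP : ∀ k x y, 0 < P k x y) (k : ℕ) (x : X) : 0 < tTiltLaw t S₀ D c P k x :=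
  tiltEvolve_pos (gibbsLaw_pos _) (fun k x => tWeight_pos t D c k x) hP k x

omit [Nonempty X] in
/-- Mass recursion of the tilted marginal for unit row sums: `m_{k+1} = Σ_x g_k(x) ν_k(x)`. -/
theorem sum_tTiltLaw_succ (t : ℝ) (S₀ D : X → ℝ) (c : ℕ → ℝ) {P : ℕ → X → X → ℝ}
    (hProw : ∀ k x, ∑ y, P k x y = 1) (k : ℕ) :
    ∑ y, tTiltLaw t S₀ D c P (k + 1) y = ∑ x, tWeight t D c k x * tTiltLaw t S₀ D c P k x :=
  sum_tiltEvolve_succ hProw _ k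

omit [Nonempty X] in
/-- **`E_F[e^{−tW}]` is the `t`-tilted mass** of the linear protocol along any grid. -/
theorem sum_pathLaw_exp_neg_mul_work_eq (t : ℝ) (S₀ D : X → ℝ) (c : ℕ → ℝ)
    (P : ℕ → X → X → ℝ) (n : ℕ) :
    ∑ ω : Fin (n + 1) → X, pathLaw (gibbsLaw (linAction S₀ D (c 0))) (fun k : Fin n => P k) ω
        * Real.exp (-(t * work (fun k : Fin (n + 1) => linAction S₀ D (c k)) ω))
      = ∑ x, tTiltLaw t S₀ D c P n x := by
  have h := sum_pathLaw_prod_mul_apply n (gibbsLaw (linAction S₀ D (c 0))) (tWeight t D c) P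
    (fun _ => 1)
  simp only [mul_one] at h
  rw [tTiltLaw, ← h]
  refine sum_congr rfl fun ω _ => ?_
  rw [exp_neg_mul_work_eq_prod]
  congr 1
  refine prod_congr rfl fun k _ => ?_
  simp only [tWeight, Fin.val_succ, Fin.val_castSucc, linAction]
  congr 1
  ring

omit [Nonempty X] in
/-- Under PERFECT relaxation (`P_k(x, ·) = π_{c_{k+1}}`) the tilted marginal is exactly
`p_k^{(t)} · π_{c_k}`. -/
theorem tTiltLaw_perfect (t : ℝ) (S₀ D : X → ℝ) (c : ℕ → ℝ) :
    ∀ k, tTiltLaw t S₀ D c (fun k _ y => gibbsLaw (linAction S₀ D (c (k + 1))) y) k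
      = fun x => tPerfMass t S₀ D c k * gibbsLaw (linAction S₀ D (c k)) x
  | 0 => by funext x; simp [tTiltLaw_zero, tPerfMass]
  | k + 1 => by
    rw [tTiltLaw_succ, tTiltLaw_perfect t S₀ D c k, tPerfMass_succ]
    funext y
    simp only [stepLaw]
    rw [← sum_mul, mul_sum]
    congr 1
    exact sum_congr rfl fun x _ => by ring

/-- **The perfect `t`-moment in free-energy form**:
`log p_n^{(t)} + t·(F(c_n) − F(c_0)) = Σ_{k<n} Λ_{c_k,δ_k}(t)` — the product of the one-step MGFs
of `Scaling/LinearFamilyStepMGF` (so `E_F^{perfect}[e^{−t(W − ΔF)}] = exp Σ_k Λ_k(t)`). -/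
theorem log_tPerfMass_add_eq_sum_stepLogMGF (t : ℝ) (S₀ D : X → ℝ) (c : ℕ → ℝ) : ∀ n,
    Real.log (tPerfMass t S₀ D c n)
        + t * (linFreeEnergy S₀ D (c n) - linFreeEnergy S₀ D (c 0))
      = ∑ k ∈ Finset.range n, stepLogMGF S₀ D (c k) (c (k + 1) - c k) t
  | 0 => by simp [tPerfMass]
  | n + 1 => by
    have ih := log_tPerfMass_add_eq_sum_stepLogMGF t S₀ D c n
    rw [Finset.sum_range_succ, ← ih, tPerfMass_succ,
      Real.log_mul (tPerfMass_pos t S₀ D c n).ne' (tEqFactor_pos t S₀ D c n).ne', tEqFactor_eq]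
    have hZ := partitionFn_pos (linAction S₀ D (c n))
    have hZt := partitionFn_pos (linAction S₀ D (c n + t * (c (n + 1) - c n)))
    rw [Real.log_div hZt.ne' hZ.ne']
    unfold stepLogMGF linFreeEnergy freeEnergy
    rw [show c n + (c (n + 1) - c n) = c (n + 1) by ring]
    ring

end Protocol

/-! ## §2 `χ²` and the variance of the one-time weight inside the family are log-MGFs -/

section Family

/-- The Pearson `χ²` of the Literature is theory-2's `1/ESS − 1` (normalised laws, positive model). -/
theorem chiSqDiv_eq_inv_essFrac_sub_one {p q : X → ℝ} (hq : ∀ x, 0 < q x) (hp1 : ∑ x, p x = 1)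
    (hq1 : ∑ x, q x = 1) : chiSqDiv p q = (essFrac p q)⁻¹ - 1 := by
  rw [essFrac_eq_inv hq hp1, inv_inv, chiSqDiv_eq_sum_sq_div]
  have h : ∀ x, (p x - q x) ^ 2 / q x = p x * weight p q x - 2 * p x + q x := by
    intro x
    have hqx : q x ≠ 0 := (hq x).ne'
    rw [mul_weight_eq_sq_div]
    field_simp
    ring
  simp_rw [h, sum_add_distrib, sum_sub_distrib, ← mul_sum, hp1, hq1]
  ring

variable [Nonempty X]

/-- **`χ²(π_{c+a} ‖ π_c) = e^{Λ_{c,a}(2)} − 1`**: the `χ²`-distance between two members of the family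
is the one-step log-MGF of order two (`Z(c+2a)Z(c)/Z(c+a)² − 1`). -/
theorem chiSqDiv_gibbsLaw_linAction_eq (S₀ D : X → ℝ) (c a : ℝ) :
    chiSqDiv (gibbsLaw (linAction S₀ D (c + a))) (gibbsLaw (linAction S₀ D c))
      = Real.exp (stepLogMGF S₀ D c a 2) - 1 := by
  rw [chiSqDiv_eq_inv_essFrac_sub_one (gibbsLaw_pos _) (sum_gibbsLaw _) (sum_gibbsLaw _),
    essFrac_gibbsLaw_linAction, exp_stepLogMGF]
  have hZ := partitionFn_pos (linAction S₀ D c)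
  have hZ1 := partitionFn_pos (linAction S₀ D (c + a))
  have hZ2 := partitionFn_pos (linAction S₀ D (c + 2 * a))
  congr 1
  have hF : Real.exp (2 * (linFreeEnergy S₀ D (c + a) - linFreeEnergy S₀ D c))
      = (partitionFn (linAction S₀ D c) / partitionFn (linAction S₀ D (c + a))) ^ 2 := by
    unfold linFreeEnergy freeEnergy
    rw [show 2 * (-Real.log (partitionFn (linAction S₀ D (c + a)))
          - -Real.log (partitionFn (linAction S₀ D c)))
        = ((2 : ℕ) : ℝ) * (Real.log (partitionFn (linAction S₀ D c))
            - Real.log (partitionFn (linAction S₀ D (c + a)))) by push_cast; ring,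
      Real.exp_nat_mul, ← Real.log_div hZ.ne' hZ1.ne', Real.exp_log (div_pos hZ hZ1)]
  rw [hF, show 2 * (c + a) - c = c + 2 * a by ring, inv_div]
  field_simp

/-- `χ²(π_{c+a} ‖ π_c) ≤ e^{a²σ̄²} − 1` when `Var_{c'}(D) ≤ σ̄²` for every `c'`
(`Λ_{c,a}(2) ≤ a²σ̄²`, `Scaling/LinearFamilyStepMGF`). -/
theorem chiSqDiv_gibbsLaw_linAction_le (S₀ D : X → ℝ) (c a : ℝ) {σbar : ℝ}
    (hσ : ∀ c', varD S₀ D c' ≤ σbar ^ 2) :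
    chiSqDiv (gibbsLaw (linAction S₀ D (c + a))) (gibbsLaw (linAction S₀ D c))
      ≤ Real.exp (a ^ 2 * σbar ^ 2) - 1 := by
  rw [chiSqDiv_gibbsLaw_linAction_eq]
  have h := stepLogMGF_le_of_varD_le S₀ D c a hσ (t := 2) (Or.inr (by norm_num))
  have h' : stepLogMGF S₀ D c a 2 ≤ a ^ 2 * σbar ^ 2 := h.trans (by norm_num)
  linarith [Real.exp_le_exp.mpr h']

/-- **`Var_{π_{c_k}}(g_k) = ḡ_k² · (e^{Λ_{c_k,tδ_k}(2)} − 1)`**: the variance of the one-time weight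
is its squared mean times the order-two log-MGF at step `tδ_k`. -/
theorem varLaw_tWeight_eq (t : ℝ) (S₀ D : X → ℝ) (c : ℕ → ℝ) (k : ℕ) :
    varLaw (gibbsLaw (linAction S₀ D (c k))) (tWeight t D c k)
      = (∑ x, gibbsLaw (linAction S₀ D (c k)) x * tWeight t D c k x) ^ 2
          * (Real.exp (stepLogMGF S₀ D (c k) (t * (c (k + 1) - c k)) 2) - 1) := by
  set a := t * (c (k + 1) - c k) with ha
  have hsq : ∀ x, tWeight t D c k x ^ 2 = Real.exp (-((2 * a) * D x)) := by
    intro x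
    rw [tWeight, ← ha, ← Real.exp_nat_mul]
    congr 1; push_cast; ring
  have h2 : ∑ x, gibbsLaw (linAction S₀ D (c k)) x * tWeight t D c k x ^ 2
      = partitionFn (linAction S₀ D (c k + 2 * a)) / partitionFn (linAction S₀ D (c k)) := by
    simp_rw [hsq]
    exact sum_gibbsLaw_linAction_mul_exp S₀ D (c k) (2 * a)
  have hZ := partitionFn_pos (linAction S₀ D (c k))
  have hZ1 := partitionFn_pos (linAction S₀ D (c k + a))
  have hF : Real.exp (2 * (linFreeEnergy S₀ D (c k + a) - linFreeEnergy S₀ D (c k)))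
      = (partitionFn (linAction S₀ D (c k)) / partitionFn (linAction S₀ D (c k + a))) ^ 2 := by
    unfold linFreeEnergy freeEnergy
    rw [show 2 * (-Real.log (partitionFn (linAction S₀ D (c k + a)))
          - -Real.log (partitionFn (linAction S₀ D (c k))))
        = ((2 : ℕ) : ℝ) * (Real.log (partitionFn (linAction S₀ D (c k)))
            - Real.log (partitionFn (linAction S₀ D (c k + a)))) by push_cast; ring,
      Real.exp_nat_mul, ← Real.log_div hZ.ne' hZ1.ne', Real.exp_log (div_pos hZ hZ1)]
  unfold varLaw
  rw [h2, tEqFactor_eq, ← ha, exp_stepLogMGF, hF]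
  field_simp

/-- `√Var_{π_{c_k}}(g_k) ≤ ḡ_k · √(e^{t²δ_k²σ̄²} − 1)` when `Var_c(D) ≤ σ̄²` for all `c`: the
relative standard deviation of the one-time weight is governed by the fluctuation scale `δ_k σ̄`
(no oscillation `ΔD`). -/
theorem sqrt_varLaw_tWeight_le (t : ℝ) (S₀ D : X → ℝ) (c : ℕ → ℝ) {σbar : ℝ}
    (hσ : ∀ c', varD S₀ D c' ≤ σbar ^ 2) (k : ℕ) :
    Real.sqrt (varLaw (gibbsLaw (linAction S₀ D (c k))) (tWeight t D c k))
      ≤ (∑ x, gibbsLaw (linAction S₀ D (c k)) x * tWeight t D c k x)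
          * Real.sqrt (Real.exp ((t * (c (k + 1) - c k)) ^ 2 * σbar ^ 2) - 1) := by
  have hg := (tEqFactor_pos t S₀ D c k).le
  rw [varLaw_tWeight_eq, Real.sqrt_mul (sq_nonneg _), Real.sqrt_sq hg]
  refine mul_le_mul_of_nonneg_left (Real.sqrt_le_sqrt ?_) hg
  have h := stepLogMGF_le_of_varD_le S₀ D (c k) (t * (c (k + 1) - c k)) hσ (t := 2)
    (Or.inr (by norm_num))
  have h' : stepLogMGF S₀ D (c k) (t * (c (k + 1) - c k)) 2
      ≤ (t * (c (k + 1) - c k)) ^ 2 * σbar ^ 2 := h.trans (by norm_num)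
  linarith [Real.exp_le_exp.mpr h']

end Family

/-! ## §3 The tilted lag bound and the sup-norm-free mass step -/

/-- Cauchy–Schwarz in `L²(π)` for a non-negative weight: `Σ π u v ≤ √(Σ π u²) · √(Σ π v²)`. -/
theorem sum_mul_mul_le_sqrt_mul_sqrt {π : X → ℝ} (hπ : ∀ x, 0 ≤ π x) (u v : X → ℝ) :
    ∑ x, π x * u x * v x
      ≤ Real.sqrt (∑ x, π x * u x ^ 2) * Real.sqrt (∑ x, π x * v x ^ 2) := by
  have hcs := Finset.sum_mul_sq_le_sq_mul_sq univ (fun x => Real.sqrt (π x) * u x)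
    (fun x => Real.sqrt (π x) * v x)
  have hs : ∀ x, Real.sqrt (π x) ^ 2 = π x := fun x => Real.sq_sqrt (hπ x)
  have e1 : ∀ x, Real.sqrt (π x) * u x * (Real.sqrt (π x) * v x) = π x * u x * v x := by
    intro x; rw [show Real.sqrt (π x) * u x * (Real.sqrt (π x) * v x)
      = Real.sqrt (π x) ^ 2 * u x * v x by ring, hs x]
  have e2 : ∀ x, (Real.sqrt (π x) * u x) ^ 2 = π x * u x ^ 2 := by
    intro x; rw [mul_pow, hs x]
  have e3 : ∀ x, (Real.sqrt (π x) * v x) ^ 2 = π x * v x ^ 2 := by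
    intro x; rw [mul_pow, hs x]
  simp_rw [e1, e2, e3] at hcs
  have hA : 0 ≤ ∑ x, π x * u x ^ 2 := sum_nonneg fun x _ => mul_nonneg (hπ x) (sq_nonneg _)
  have hB : 0 ≤ ∑ x, π x * v x ^ 2 := sum_nonneg fun x _ => mul_nonneg (hπ x) (sq_nonneg _)
  rw [← Real.sqrt_mul hA]
  exact Real.le_sqrt_of_sq_le hcs

/-- **THE TILTED LAG BOUND (Cauchy–Schwarz).**  For a positive probability vector `π`, any `ν` and
any weight `g`: `|ν[g] − |ν|·π[g]| ≤ √Var_π(g) · massDev π ν` — the mass picked up by tilting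
differs from the equilibrium factor `π[g]` by at most the standard deviation of `g` times the
`L²(1/π)` deviation of `ν` from its own-mass multiple of `π`. -/
theorem abs_sum_mul_sub_mass_mul_le {π : X → ℝ} (hπ : ∀ x, 0 < π x) (hπ1 : ∑ x, π x = 1)
    (ν g : X → ℝ) :
    |∑ x, g x * ν x - (∑ x, ν x) * ∑ x, π x * g x|
      ≤ Real.sqrt (varLaw π g) * massDev π ν := by
  set m := ∑ x, ν x with hm
  set gbar := ∑ x, π x * g x with hgbar
  -- the deviation density h = ν/π − m (mean zero under π)
  set h : X → ℝ := fun x => ν x / π x - m with hh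
  have hid : ∑ x, g x * ν x - m * gbar = ∑ x, π x * (g x - gbar) * h x := by
    have e : ∀ x, π x * (g x - gbar) * h x
        = g x * ν x - m * (π x * g x) - gbar * ν x + gbar * m * π x := by
      intro x; rw [hh]; field_simp [(hπ x).ne']; ring
    simp_rw [e, sum_add_distrib, sum_sub_distrib, ← mul_sum]
    rw [← hgbar, ← hm, hπ1]
    ring
  have hvar : ∑ x, π x * (g x - gbar) ^ 2 = varLaw π g := by
    rw [varLaw_eq_sum_sq_dev hπ1, ← hgbar]
  have hdev : ∑ x, π x * h x ^ 2 = massDev π ν ^ 2 := by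
    rw [massDev_sq hπ, ← hm]
    refine sum_congr rfl fun x _ => ?_
    rw [hh]; field_simp [(hπ x).ne']
  have hπ0 : ∀ x, 0 ≤ π x := fun x => (hπ x).le
  have hcs1 := sum_mul_mul_le_sqrt_mul_sqrt hπ0 (fun x => g x - gbar) h
  have hcs2 := sum_mul_mul_le_sqrt_mul_sqrt hπ0 (fun x => g x - gbar) (fun x => -h x)
  have e2 : ∀ x, (-h x) ^ 2 = h x ^ 2 := fun x => by ring
  have e3 : ∑ x, π x * (g x - gbar) * -h x = -∑ x, π x * (g x - gbar) * h x := by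
    rw [← sum_neg_distrib]; exact sum_congr rfl fun x _ => by ring
  simp_rw [e2] at hcs2
  rw [e3, hvar, hdev, Real.sqrt_sq (massDev_nonneg π ν)] at hcs2
  rw [hvar, hdev, Real.sqrt_sq (massDev_nonneg π ν)] at hcs1
  rw [hid, abs_le]
  constructor <;> linarith

/-- **THE SUP-NORM-FREE MASS STEP.**  For layers with unit row sums:
`|m_{k+1} − ḡ_k·m_k| ≤ ḡ_k·√(e^{Λ_{c_k,tδ_k}(2)} − 1)·E_k`, `m_k = |ν_k^{(t)}|`,
`E_k = massDev π_{c_k} ν_k^{(t)}` — the coefficient is a one-step log-MGF of the family, with no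
factor `e^{|t|δ_k ΔD/2}` (compare the staged `χ²`-route mass step). -/
theorem abs_sum_tTiltLaw_succ_sub_le [Nonempty X] (t : ℝ) (S₀ D : X → ℝ) (c : ℕ → ℝ)
    {P : ℕ → X → X → ℝ} (hProw : ∀ k x, ∑ y, P k x y = 1) (k : ℕ) :
    |∑ x, tTiltLaw t S₀ D c P (k + 1) x
        - (∑ x, gibbsLaw (linAction S₀ D (c k)) x * tWeight t D c k x)
            * ∑ x, tTiltLaw t S₀ D c P k x|
      ≤ (∑ x, gibbsLaw (linAction S₀ D (c k)) x * tWeight t D c k x)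
          * Real.sqrt (Real.exp (stepLogMGF S₀ D (c k) (t * (c (k + 1) - c k)) 2) - 1)
          * massDev (gibbsLaw (linAction S₀ D (c k))) (tTiltLaw t S₀ D c P k) := by
  have hg := (tEqFactor_pos t S₀ D c k).le
  rw [sum_tTiltLaw_succ t S₀ D c hProw k]
  have hlag := abs_sum_mul_sub_mass_mul_le (gibbsLaw_pos (linAction S₀ D (c k))) (sum_gibbsLaw _)
    (tTiltLaw t S₀ D c P k) (tWeight t D c k)
  rw [mul_comm (∑ x, tTiltLaw t S₀ D c P k x)] at hlag
  refine hlag.trans (le_of_eq ?_)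
  rw [varLaw_tWeight_eq, Real.sqrt_mul (sq_nonneg _), Real.sqrt_sq hg]

/-- One-sided form of the mass step with the fluctuation bound folded in:
`m_{k+1} ≤ ḡ_k·(m_k + √(e^{t²δ_k²σ̄²} − 1)·E_k)` when `Var_c(D) ≤ σ̄²` for all `c`. -/
theorem sum_tTiltLaw_succ_le_of_varD_le [Nonempty X] (t : ℝ) (S₀ D : X → ℝ) (c : ℕ → ℝ)
    {P : ℕ → X → X → ℝ} (hProw : ∀ k x, ∑ y, P k x y = 1) {σbar : ℝ}
    (hσ : ∀ c', varD S₀ D c' ≤ σbar ^ 2) (k : ℕ) :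
    ∑ x, tTiltLaw t S₀ D c P (k + 1) x
      ≤ (∑ x, gibbsLaw (linAction S₀ D (c k)) x * tWeight t D c k x)
          * (∑ x, tTiltLaw t S₀ D c P k x
              + Real.sqrt (Real.exp ((t * (c (k + 1) - c k)) ^ 2 * σbar ^ 2) - 1)
                  * massDev (gibbsLaw (linAction S₀ D (c k))) (tTiltLaw t S₀ D c P k)) := by
  have hg := (tEqFactor_pos t S₀ D c k).le
  have hE := massDev_nonneg (gibbsLaw (linAction S₀ D (c k))) (tTiltLaw t S₀ D c P k)
  have h := (le_abs_self _).trans (abs_sum_tTiltLaw_succ_sub_le t S₀ D c hProw k)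
  have hs : Real.sqrt (Real.exp (stepLogMGF S₀ D (c k) (t * (c (k + 1) - c k)) 2) - 1)
      ≤ Real.sqrt (Real.exp ((t * (c (k + 1) - c k)) ^ 2 * σbar ^ 2) - 1) := by
    refine Real.sqrt_le_sqrt ?_
    have h2 := stepLogMGF_le_of_varD_le S₀ D (c k) (t * (c (k + 1) - c k)) hσ (t := 2)
      (Or.inr (by norm_num))
    have h2' : stepLogMGF S₀ D (c k) (t * (c (k + 1) - c k)) 2
        ≤ (t * (c (k + 1) - c k)) ^ 2 * σbar ^ 2 := h2.trans (by norm_num)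
    linarith [Real.exp_le_exp.mpr h2']
  have := mul_le_mul_of_nonneg_left (mul_le_mul_of_nonneg_right hs hE) hg
  nlinarith [this, h]

end Summit.Ventures.LatticeQCDFlow.Scaling
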